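import Summits.QuantumFields.YangMills.Theorems.BalabanUVNodesN11AFibreDominationOnJointSupport
import Summits.QuantumFields.YangMills.Theorems.BalabanUVNodesN11TkBranchReadingLocus
import Summits.QuantumFields.YangMills.Theorems.BalabanUVNodesN11NoExpansionAllLargeCoP
import Literature.MathematicalPhysics.QuantumFieldTheory.Balaban1983to89.Node00.Record12LocalLawsTwoScale

/-!
# DAG node N11 — THE READING-LOCUS MACHINERY UNDER PRINT'S TWO-SCALE LOCALITY OF THE RESIDUAL FACTOR `ζ_j` (scales `j` AND `j+1`):
# n11-w4's congruence ∕ integrability theorems on the reading locus and their generic-`θ` corollary, with 12b's one-scale row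
# `ω j = ω′ j → ζ0 j Y ω = ζ0 j Y ω′` WEAKENED to `ω j = ω′ j → ω (j+1) = ω′ (j+1) → ζ0 j Y ω = ζ0 j Y ω′`

HEADER — WORK-UNIT METADATA.  Cell `pub-ymgap`, YM-PLAN Track A (HUMAN RULING D-0062), seat `pub-ymgap-dag-n11-d` (g31) on NODE n11 [B14]; route `BalabanUVNodes`,
item K1⁹ `StabilityBRunRowsAtRecordR13SepCoPHV` = stmt-QuantumFields-27364 (helper, `--kind proof --supports 27364 --as helper`, count-neutral).  Editions of
n11-w4 g2's `…N11TkBranchReadingLocus` §1–§3 (proofs VERBATIM but for ONE extra agreement line in §1) and of the k-locality one-liners of this seat's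
`…N11NoExpansionDiagonalAtZ` ∕ `…N11NoExpansionAllLargeCoP`.  [III] = [Balaban1988Convergent].

WHY THIS FILE (located, count-neutral; dag-n11-d g19 memo `N11-G19-LOCAL-RESIDUAL-ROAD.md` #40 on 27364, repair (b′); g31 bus line 2026-08-29 ≈03:12Z).
[III] p.264 L-9ff ∕ (3.2) p.265 ∕ p.267: the residual factor `ζ(Ω^c_{k+1})` of generation `k` is the resummation of the (3.2)∕(3.3) characteristic functions and
gauge-fixing factors localized in `Ω_k ∖ Ω_{k+1}` — it READS THE NEW FIELD `V_{k+1}` (in 11a's indexing `(ω (k+1)).1`).  12b's locality row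
`TkResidualW.LocalLaws.zeta0_local` (`Node00/Record12`; = the field `zhLocal` of `Provisos₁₃CoPH` ∕ `Provisos₁₃SepCoPH`) lets `ζ0 j` read `ω j` ONLY, and with
11a's base-configuration reading that row forces the top pair's main term to be absent at every lawful `θ` (g19 `…N11TopPairLocalResidual`).  This file certifies
that the READING-LOCUS machinery every no-expansion 𝐓-step theorem of this lane rests on needs only the print-faithful TWO-SCALE law: inside `𝐓_k` generation
`m` modifies component `m` only, and `ζ_i` (`i > m`) is compared at configurations differing at component `m < i` — so components `i` AND `i+1` agree.

WHAT THIS FILE PROVES (0 `sorry`, 0 `def`; standard axioms).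
§1 `tkWeightsOfRecordP_ζ_local_lt` ∕ `WtOfRecord₁₃P_ζ_local_lt` ∕ `WtOfRecord₁₃H_ζ_local_lt` — k-locality of `ζ_j` for `j < k` from node00's two-scale law
   `TkResidualW.LocalLaws₂` (`Node00/Record12LocalLawsTwoScale`; the form the seven leaf files consume).
§2 ★★ `tkBranchOfRecord_congr_on_reading_locus₂` — n11-w4's §1 under the two-scale `hζloc`.
§3 ★★ `integrable_front_mul_tkBranchOfRecord_baseCfg_of_dominated_on_reading_locus₂` — n11-w4's §2 under the two-scale `hζloc`.
§4 ★★★ `integrable_front_mul_oldBranch_of_coercive_on_reading_locus₂` — n11-w4's §3 at generic `θ` with the LOCALITY hypothesis `(θ.zhAt p s′).LocalLaws₂`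
   (node00's two-scale law, displayed) in place of the core proviso `zhLocal` (which implies it: `LocalLaws.localLaws₂`, `zhAt_localLaws₂`).

HONEST FRAMING.  Helper lane of K1⁹; generalizations (weaker hypothesis) of accepted tree theorems, proofs verbatim modulo one line; no law of record is edited or
posited — the two-scale law is a DISPLAYED HYPOTHESIS (node00's `LocalLaws₂`, or its coarse consequence at the generic `TkWeights` level), implied by the row
of record (`TkResidualW.LocalLaws.localLaws₂`), so every existing caller is served.  Nothing of Bałaban asserted or
refuted; K1⁹ `∃θ` NOT refuted; N11 NOT discharged; counts unmoved (typed 28∕28 · discharged 7∕27).  One finite four-torus programme at fixed `ε = L^{−K}`; NOT ℝ⁴,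
NOT OS, NOT a mass gap, NOT Clay.  No `sorry`, `axiom`, `def`, `instance`, `notation`.
Sources (SHAPE only): [III] (2.10) p.256, (2.18) p.257, (2.20)–(2.23) p.258, (3.2)–(3.3) p.265, p.267, (3.23)–(3.24) p.270; [Balaban1987RG1] (2.11) p.267.
-/

noncomputable section

open MeasureTheory
open scoped BigOperators ENNReal NNReal

namespace Summit.QuantumFields.YangMills.Theorems.BalabanUVNodesN11TwoScaleLocalityReadingLocus

open Literature.MathematicalPhysics.QuantumFieldTheory.Balaban1983to89 T4Continuum T4NestedCovariance T4AdjointCovariance Node00 Node00.Tk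
open B15DeterminingSets (MSField)
open B10Eq42TorusConstraint (bondsIn)
open BalabanUVNodesN11TkBranchMassBound (integrable_tkBranchOfRecord_baseCfg_of_dominated)
open BalabanUVNodesN11AFibreDominationOnSupport (aOp_congr_of_eq_on_fibre)
open BalabanUVNodesN11AFibreDominationOnJointSupport (afibre_dominated_under_of_coercive_under)
open BalabanUVNodesN11OldBranchIntegrableOfDominated (zhAt_ζ0_le_one_of_unity)
open BalabanUVNodesN11DiagonalOldBranchMeasurable (measurable_WtOfRecord₁₃H_ζ measurable_WtOfRecord₁₃H_w)
open BalabanUVNodesN11NoExpansionDiagonalCoPH (WtOfRecord₁₃H_eq_tkWeightsOfRecordP)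
open BalabanUVNodesN11NoExpansionDiagonalAtZ (tkWeightsOfRecordP_ζ_apply)

/-! ## §1  k-locality below `k` of 12a″'s `ζ`-field from the two-scale law `TkResidualW.LocalLaws₂` (the form the leaf files consume) -/
section TwoScale

variable {F : T4Family} {N : ℕ} [NeZero N]
variable {ν : Stage7Numerics} {A₁ : ℝ} {p : B12.RunParams} {g : ℕ → ℝ} {Z : TkResidualW F N (FluctV N) p.K}

/-- Under the TWO-SCALE law `Z.LocalLaws₂` the `ζ`-field of 12a″'s weights over `Z` at generation `j < k` is `k`-local — agreement at all scales `≤ k` suffices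
(the `hζloc` the seven no-expansion leaf files display; edition of `…N11NoExpansionDiagonalAtZ.tkWeightsOfRecordP_ζ_local`, which needs 12b's one-scale row and
is stated at `j ≤ k` but consumed at `j < k` only). [cite: Balaban1988Convergent, (3.2)–(3.3) p.265, p.267, (1.11) p.248] -/
theorem tkWeightsOfRecordP_ζ_local_lt (hloc₂ : Z.LocalLaws₂) {k j : ℕ} (hj : j < k) (Y : Set (Site (F.P p.K) 0))
    (ω ω' : MultiCfg (F.P p.K) (SU N) (FluctV N)) (h : ∀ i, i ≤ k → ω i = ω' i) :
    (tkWeightsOfRecordP F N (FluctV N) ν A₁ p g Z).ζ j Y ω = (tkWeightsOfRecordP F N (FluctV N) ν A₁ p g Z).ζ j Y ω' :=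
  hloc₂.zeta0_local_lt hj Y ω ω' h

/-- The same for 12a″'s weights OF RECORD at `θ : Stage13Params` (edition of `…N11NoExpansionAllLargeCoP.WtOfRecord₁₃P_ζ_local`).
[cite: Balaban1988Convergent, (3.2)–(3.3) p.265, p.267, (1.11) p.248] -/
theorem WtOfRecord₁₃P_ζ_local_lt (θ : Stage13Params F N) (p : B12.RunParams) (hloc₂ : (θ.Zt p.K).LocalLaws₂) {k j : ℕ} (hj : j < k)
    (Y : Set (Site (F.P p.K) 0)) (ω ω' : MultiCfg (F.P p.K) (SU N) (FluctV N)) (h : ∀ i, i ≤ k → ω i = ω' i) :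
    (WtOfRecord₁₃P F N θ p).ζ j Y ω = (WtOfRecord₁₃P F N θ p).ζ j Y ω' :=
  hloc₂.zeta0_local_lt hj Y ω ω' h

/-- … and for the history's residual `θ.zhAt p s′` at `θ : Stage13HParams` (the weights `WtOfRecord₁₃H θ p s′` the `CoPH` no-expansion theorems read).
[cite: Balaban1988Convergent, (3.2)–(3.3) p.265, p.267, (3.16)–(3.20) pp.268–269] -/
theorem WtOfRecord₁₃H_ζ_local_lt (θ : Stage13HParams F N) (p : B12.RunParams) {n : ℕ}
    (s : SeqOfRecord F θ.ν θ.τ9.M (gOfRecord₁₃ F N θ.toStage13Params p) p.K n) (hloc₂ : (θ.zhAt p s).LocalLaws₂) {k j : ℕ} (hj : j < k)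
    (Y : Set (Site (F.P p.K) 0)) (ω ω' : MultiCfg (F.P p.K) (SU N) (FluctV N)) (h : ∀ i, i ≤ k → ω i = ω' i) :
    (WtOfRecord₁₃H F N θ p s).ζ j Y ω = (WtOfRecord₁₃H F N θ p s).ζ j Y ω' := by
  rw [WtOfRecord₁₃H_eq_tkWeightsOfRecordP]
  exact hloc₂.zeta0_local_lt hj Y ω ω' h

end TwoScale

/-! ## §2  Generic: n11-w4's congruence on the READING LOCUS under the two-scale locality of `ζ` -/
section Congr

variable {F : T4Family} {N : ℕ} [NeZero N] {V : Type} [NormedAddCommGroup V] [InnerProductSpace ℝ V] [FiniteDimensional ℝ V]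
  [MeasurableSpace V] [BorelSpace V]
variable (ν : Stage7Numerics) (M : ℕ) (g : ℕ → ℝ) (K : ℕ)

/-- **★★ CONGRUENCE OF THE BRANCH OPERATORS ON THE READING LOCUS — under the TWO-SCALE locality of `ζ_j` (`j < k`).**  As p598996's `tkBranchOfRecord_congr_on_joint_support`, with ONE more invariant: the
A-weights need agree only at configurations `ω′` whose components `< j` coincide with those of a REFERENCE configuration `ω₀` (generation `m` modifies component `m`
only, so inside `𝐓_m` the components `< m` are still the caller's); conclusion at every `Amb` configuration agreeing with `ω₀` below `k`.
[cite: Balaban1988Convergent, (2.20)–(2.21) p.258, (3.24) p.270, (2.10) p.256] -/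
theorem tkBranchOfRecord_congr_on_reading_locus₂ (W W' : TkWeights F N V K) {n : ℕ} (s : SeqOfRecord F ν M g K n) (S : ℕ → Set (Site (F.P K) 0))
    (k : ℕ) (ω₀ : MultiCfg (F.P K) (SU N) V) (Amb : MultiCfg (F.P K) (SU N) V → Prop)
    (hAmb : ∀ ω ω' : MultiCfg (F.P K) (SU N) V, (∀ i, k ≤ i → ω' i = ω i) → Amb ω → Amb ω')
    (hζ : ∀ j, j < k → W'.ζ j (s.Ω (j + 1))ᶜ = W.ζ j (s.Ω (j + 1))ᶜ)
    (hζloc : ∀ j, j < k → ∀ ω ω' : MultiCfg (F.P K) (SU N) V, ω j = ω' j → ω (j + 1) = ω' (j + 1) →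
      W.ζ j (s.Ω (j + 1))ᶜ ω = W.ζ j (s.Ω (j + 1))ᶜ ω')
    (hw : ∀ j, j < k → ∀ ω' : MultiCfg (F.P K) (SU N) V, Amb ω' → (∀ i, i < j → ω' i = ω₀ i) →
      (∀ i, j ≤ i → i < k → ∃ c : JCfg (F.P K) i (SU N) V, c.1 = (ω' i).1 ∧
        (∀ b, b ∉ bondsIn i ((s.Λ (i + 1))ᶜ ∩ s.Ω (i + 1)) → c.2 b = (ω' i).2 b) ∧ W.ζ i (s.Ω (i + 1))ᶜ (Function.update ω' i c) ≠ 0) →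
      W'.w j (s.Λ (j + 1)) ((s.Λ (j + 1))ᶜ ∩ s.Ω (j + 1)) (S (j + 1)) ω' = W.w j (s.Λ (j + 1)) ((s.Λ (j + 1))ᶜ ∩ s.Ω (j + 1)) (S (j + 1)) ω')
    (Φ : MultiCfg (F.P K) (SU N) V → ℝ) (ω : MultiCfg (F.P K) (SU N) V) (hω : Amb ω) (hω₀ : ∀ i, i < k → ω i = ω₀ i) :
    tkBranchOfRecord F N V ν M g K W' s S k Φ ω = tkBranchOfRecord F N V ν M g K W s S k Φ ω := by
  -- the induction over the generations, on VALUES, carrying the ambient predicate and the certificates of the generations `≥ m`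
  have key : ∀ m, m ≤ k → ∀ ω : MultiCfg (F.P K) (SU N) V, Amb ω → (∀ i, i < m → ω i = ω₀ i) →
      (∀ i, m ≤ i → i < k → ∃ c : JCfg (F.P K) i (SU N) V, c.1 = (ω i).1 ∧
        (∀ b, b ∉ bondsIn i ((s.Λ (i + 1))ᶜ ∩ s.Ω (i + 1)) → c.2 b = (ω i).2 b) ∧ W.ζ i (s.Ω (i + 1))ᶜ (Function.update ω i c) ≠ 0) →
      tkBranchOfRecord F N V ν M g K W' s S m Φ ω = tkBranchOfRecord F N V ν M g K W s S m Φ ω := by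
    intro m
    induction m with
    | zero => intro _ ω _ _ _; rfl
    | succ m ih =>
        intro hm ω hAω hlow hsupp
        have hmk : m < k := Nat.lt_of_succ_le hm
        -- 11a's generations carry the CLASSICAL `DecidableEq` on bonds
        letI hdec : DecidableEq (PBond (F.P K) m) := fun a b => Classical.propDecidable (a = b)
        rw [tkBranchOfRecord_succ, tkBranchOfRecord_succ]
        simp only [genOp_apply, vOp_apply, zetaOp_apply]
        show kernelRTOfRecord F N K m _ _ _ _ = kernelRTOfRecord F N K m _ _ _ _
        congr 1
        funext y
        -- the configuration after the V-update of generation `m`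
        set ωy : MultiCfg (F.P K) (SU N) V := Function.update ω m
          (Function.updateFinset (ω m).1 (Set.toFinite (bondsIn m (s.Ω (m + 1))ᶜ)).toFinset y, (ω m).2) with hωy
        have hωy_ne : ∀ i, i ≠ m → ωy i = ω i := fun i hi => by rw [hωy, Function.update_of_ne hi]
        show W'.ζ m (s.Ω (m + 1))ᶜ ωy * _ = W.ζ m (s.Ω (m + 1))ᶜ ωy * _
        rw [hζ m hmk]
        by_cases hζ0 : W.ζ m (s.Ω (m + 1))ᶜ ωy = 0
        · rw [hζ0, zero_mul, zero_mul]
        · congr 1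
          rw [aOp_apply, aOp_apply]
          refine congrArg (fun φ : (↥(Set.toFinite (bondsIn m ((s.Λ (m + 1))ᶜ ∩ s.Ω (m + 1)))).toFinset → V) → ℝ =>
            ∫ a, φ a ∂(Measure.pi fun _ => (volume : Measure V))) (funext fun a => ?_)
          -- the configuration after the A-update: on the `A_m`-fibre of `ωy`, components `≠ m` untouched
          set ωa : MultiCfg (F.P K) (SU N) V := Function.update ωy m
            (insA (Set.toFinite (bondsIn m ((s.Λ (m + 1))ᶜ ∩ s.Ω (m + 1)))).toFinset a (ωy m)) with hωa
          have hωa_ne : ∀ i, i ≠ m → ωa i = ω i := fun i hi => by rw [hωa, Function.update_of_ne hi, hωy_ne i hi]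
          have hωa_m1 : (ωa m).1 = (ωy m).1 := by rw [hωa, Function.update_self]; rfl
          have hωa_m2 : ∀ b, b ∉ bondsIn m ((s.Λ (m + 1))ᶜ ∩ s.Ω (m + 1)) → (ωy m).2 b = (ωa m).2 b := fun b hb => by
            have h' : (ωa m).2 b = (ωy m).2 b := by
              rw [hωa, Function.update_self]
              show Function.updateFinset (ωy m).2 _ a b = (ωy m).2 b
              rw [Function.updateFinset_def]
              exact dif_neg fun h => hb ((Set.Finite.mem_toFinset _).mp h)
            exact h'.symm
          have hωa_back : Function.update ωa m (ωy m) = ωy := by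
            rw [hωa, Function.update_idem, Function.update_eq_self]
          have hAa : Amb ωa := hAmb ω ωa (fun i hi => hωa_ne i (Nat.ne_of_lt (lt_of_lt_of_le hmk hi)).symm) hAω
          have hlowa : ∀ i, i < m → ωa i = ω₀ i := fun i hi => by rw [hωa_ne i (Nat.ne_of_lt hi)]; exact hlow i (Nat.lt_succ_of_lt hi)
          -- the joint support at `ωa` for every `i ∈ [m, k)`
          have hsuppa : ∀ i, m ≤ i → i < k → ∃ c : JCfg (F.P K) i (SU N) V, c.1 = (ωa i).1 ∧
              (∀ b, b ∉ bondsIn i ((s.Λ (i + 1))ᶜ ∩ s.Ω (i + 1)) → c.2 b = (ωa i).2 b) ∧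
              W.ζ i (s.Ω (i + 1))ᶜ (Function.update ωa i c) ≠ 0 := by
            intro i hmi hik
            by_cases him : i = m
            · subst him
              refine ⟨ωy i, hωa_m1.symm, hωa_m2, ?_⟩
              rw [hωa_back]
              exact hζ0
            · obtain ⟨c, hc1, hc2, hcζ⟩ := hsupp i (by omega) hik
              refine ⟨c, by rw [hωa_ne i him]; exact hc1, fun b hb => by rw [hωa_ne i him]; exact hc2 b hb, ?_⟩
              rw [hζloc i hik (Function.update ωa i c) (Function.update ω i c) (by rw [Function.update_self, Function.update_self])
                (by rw [Function.update_of_ne (Nat.succ_ne_self i), Function.update_of_ne (Nat.succ_ne_self i), hωa_ne (i + 1) (by omega)])]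
              exact hcζ
          show W'.w m (s.Λ (m + 1)) ((s.Λ (m + 1))ᶜ ∩ s.Ω (m + 1)) (S (m + 1)) ωa * tkBranchOfRecord F N V ν M g K W' s S m Φ ωa =
            W.w m (s.Λ (m + 1)) ((s.Λ (m + 1))ᶜ ∩ s.Ω (m + 1)) (S (m + 1)) ωa * tkBranchOfRecord F N V ν M g K W s S m Φ ωa
          rw [hw m hmk ωa hAa hlowa hsuppa, ih hmk.le ωa hAa hlowa hsuppa]
  exact key k le_rfl ω hω hω₀ (fun i hi hik => absurd hik (not_lt.mpr hi))

end Congr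

/-! ## §3  ★★ Generic C2 level under the two-scale locality: `front · 𝐓_k(s,S)[Φ](base_k ·)` integrable under A-fibre domination ON THE READING LOCUS -/
section ReadingLocus

variable {F : T4Family} {N : ℕ} [NeZero N] {V : Type} [NormedAddCommGroup V] [InnerProductSpace ℝ V] [FiniteDimensional ℝ V]
  [MeasurableSpace V] [BorelSpace V]
variable (ν : Stage7Numerics) (M : ℕ) (g : ℕ → ℝ) (K : ℕ) (W : TkWeights F N V K)

/-- **★★ `U₀ ↦ f(U₀)·𝐓_k(s,S)[Φ](base_k U₀)` IS INTEGRABLE UNDER A-FIBRE DOMINATION ON THE READING LOCUS, two-scale locality of `ζ`** — dag-n11-d's C2 §5 with a bounded measurable front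
factor `f` and its domination row asked, for `j < k`, ONLY at configurations `ω′` with: (L1) the scales `i < j` at the base, `ω′ i = (1, 0)`; (L2) the scales `i > k` at
the base and the level-`k` fluctuation variables zero, with `f((ω′ k).1) ≠ 0`; (L3) for every `i ∈ [j,k)` an `A_i`-fibre-mate with `ζ_i((Ω_{i+1})ᶜ) ≠ 0`.  Requires the
locality of `ζ_i` (`i < k`).  (Guarded weights; §1 with reference `base_k U₀` and the ambient predicate «components `≥ k` are those of `base_k U` for some `U` with
`f U ≠ 0`»; C2 §5; `Integrable.mul_bdd`.) [cite: Balaban1988Convergent, (2.18) p.257, (2.20)–(2.21) p.258, (3.23)–(3.24) p.270, (2.10) p.256] -/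
theorem integrable_front_mul_tkBranchOfRecord_baseCfg_of_dominated_on_reading_locus₂ {n : ℕ} (s : SeqOfRecord F ν M g K n)
    (S : ℕ → Set (Site (F.P K) 0)) (k : ℕ)
    (hζm : ∀ j, Measurable (W.ζ j (s.Ω (j + 1))ᶜ)) (hζ0 : ∀ j ω, 0 ≤ W.ζ j (s.Ω (j + 1))ᶜ ω) (hζ1 : ∀ j ω, W.ζ j (s.Ω (j + 1))ᶜ ω ≤ 1)
    (hζloc : ∀ j, j < k → ∀ ω ω' : MultiCfg (F.P K) (SU N) V, ω j = ω' j → ω (j + 1) = ω' (j + 1) →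
      W.ζ j (s.Ω (j + 1))ᶜ ω = W.ζ j (s.Ω (j + 1))ᶜ ω')
    (hwm : ∀ j, Measurable (W.w j (s.Λ (j + 1)) ((s.Λ (j + 1))ᶜ ∩ s.Ω (j + 1)) (S (j + 1))))
    (hw0 : ∀ j ω, 0 ≤ W.w j (s.Λ (j + 1)) ((s.Λ (j + 1))ᶜ ∩ s.Ω (j + 1)) (S (j + 1)) ω)
    (ŵ : (j : ℕ) → (↥(Set.toFinite (bondsIn j ((s.Λ (j + 1))ᶜ ∩ s.Ω (j + 1)))).toFinset → V) → ℝ≥0∞) (hŵm : ∀ j, Measurable (ŵ j))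
    (f : GaugeField (F.P K) k (SU N) → ℝ) (hfm : Measurable f) (Cf : ℝ) (hfb : ∀ U, |f U| ≤ Cf)
    (hdom : ∀ j, j < k → ∀ ω' : MultiCfg (F.P K) (SU N) V,
      -- (L1) the inner scales still at the base configuration
      (∀ i, i < j → ω' i = ((fun _ => 1), (fun _ => 0))) →
      -- (L2) the scales `≥ k` as at the base configuration of SOME `U` with the front factor alive
      (∃ U : GaugeField (F.P K) k (SU N), f U ≠ 0 ∧ ∀ i, k ≤ i → ω' i = baseCfg (V := V) k U i) →
      -- (L3) the outer certificates alive
      (∀ i, j ≤ i → i < k → ∃ c : JCfg (F.P K) i (SU N) V, c.1 = (ω' i).1 ∧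
        (∀ b, b ∉ bondsIn i ((s.Λ (i + 1))ᶜ ∩ s.Ω (i + 1)) → c.2 b = (ω' i).2 b) ∧ W.ζ i (s.Ω (i + 1))ᶜ (Function.update ω' i c) ≠ 0) →
      ENNReal.ofReal (W.w j (s.Λ (j + 1)) ((s.Λ (j + 1))ᶜ ∩ s.Ω (j + 1)) (S (j + 1)) ω') ≤
        ŵ j (fun b : ↥(Set.toFinite (bondsIn j ((s.Λ (j + 1))ᶜ ∩ s.Ω (j + 1)))).toFinset => (ω' j).2 b))
    (Cw : ℕ → ℝ≥0) (hCw : ∀ j, ∫⁻ a, ŵ j a ∂(Measure.pi fun _ : ↥(Set.toFinite (bondsIn j ((s.Λ (j + 1))ᶜ ∩ s.Ω (j + 1)))).toFinset => (volume : Measure V)) ≤ Cw j)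
    {Φ : MultiCfg (F.P K) (SU N) V → ℝ} (hΦm : Measurable Φ) (hΦ0 : ∀ ω, 0 ≤ Φ ω) (CΦ : ℝ) (hΦle : ∀ ω, Φ ω ≤ CΦ) :
    Integrable (fun U₀ : GaugeField (F.P K) k (SU N) => f U₀ * tkBranchOfRecord F N V ν M g K W s S k Φ (baseCfg k U₀))
      (fieldMeasure (F.P K) k (SU N)) := by
  -- the guard sets and the guarded weights (as in `…N11AFibreDominationOnSupport` §2)
  let Gd : ℕ → Set (MultiCfg (F.P K) (SU N) V) := fun j =>
    {ω | ENNReal.ofReal (W.w j (s.Λ (j + 1)) ((s.Λ (j + 1))ᶜ ∩ s.Ω (j + 1)) (S (j + 1)) ω) ≤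
      ŵ j (fun b : ↥(Set.toFinite (bondsIn j ((s.Λ (j + 1))ᶜ ∩ s.Ω (j + 1)))).toFinset => (ω j).2 b)}
  have hproj : ∀ j, Measurable (fun ω : MultiCfg (F.P K) (SU N) V =>
      (fun b : ↥(Set.toFinite (bondsIn j ((s.Λ (j + 1))ᶜ ∩ s.Ω (j + 1)))).toFinset => (ω j).2 b)) := fun j =>
    measurable_pi_lambda _ fun b => (measurable_pi_apply (b : PBond (F.P K) j)).comp (measurable_snd.comp (measurable_pi_apply j))
  have hGd : ∀ j, MeasurableSet (Gd j) := fun j => measurableSet_le (hwm j).ennreal_ofReal ((hŵm j).comp (hproj j))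
  let W' : TkWeights F N V K := ⟨W.ζ, W.quad, fun j Y S' => (Gd j).indicator (W.chiA j Y S')⟩
  have hw' : ∀ (j : ℕ) (Λ' Y S' : Set (Site (F.P K) 0)), W'.w j Λ' Y S' = (Gd j).indicator (W.w j Λ' Y S') := by
    intro j Λ' Y S'
    funext ω
    show (Gd j).indicator (W.chiA j Y S') ω * Real.exp (-(1 / 2 : ℝ) * W.quad j Λ' ω) =
      (Gd j).indicator (fun ω => W.chiA j Y S' ω * Real.exp (-(1 / 2 : ℝ) * W.quad j Λ' ω)) ω
    exact (Set.indicator_mul_left (Gd j) (W.chiA j Y S') (fun ω => Real.exp (-(1 / 2 : ℝ) * W.quad j Λ' ω))).symm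
  have hwm' : ∀ j, Measurable (W'.w j (s.Λ (j + 1)) ((s.Λ (j + 1))ᶜ ∩ s.Ω (j + 1)) (S (j + 1))) := fun j => by
    rw [hw']
    exact (hwm j).indicator (hGd j)
  have hw0' : ∀ j ω, 0 ≤ W'.w j (s.Λ (j + 1)) ((s.Λ (j + 1))ᶜ ∩ s.Ω (j + 1)) (S (j + 1)) ω := fun j ω => by
    rw [hw']
    exact Set.indicator_nonneg (fun ω _ => hw0 j ω) ω
  have hdom' : ∀ j ω, ENNReal.ofReal (W'.w j (s.Λ (j + 1)) ((s.Λ (j + 1))ᶜ ∩ s.Ω (j + 1)) (S (j + 1)) ω) ≤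
      ŵ j (fun b : ↥(Set.toFinite (bondsIn j ((s.Λ (j + 1))ᶜ ∩ s.Ω (j + 1)))).toFinset => (ω j).2 b) := fun j ω => by
    rw [hw']
    by_cases hω : ω ∈ Gd j
    · rw [Set.indicator_of_mem hω]
      exact hω
    · rw [Set.indicator_of_notMem hω, ENNReal.ofReal_zero]
      exact bot_le
  -- C2 §5 at the guarded weights, times the bounded front factor
  have hB : Integrable (fun U₀ : GaugeField (F.P K) k (SU N) => tkBranchOfRecord F N V ν M g K W' s S k Φ (baseCfg k U₀))
      (fieldMeasure (F.P K) k (SU N)) :=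
    integrable_tkBranchOfRecord_baseCfg_of_dominated ν M g K W' s S hζm hζ0 hζ1 hwm' hw0' ŵ hŵm hdom' Cw hCw hΦm hΦ0 CΦ hΦle k
  have hBf : Integrable (fun U₀ : GaugeField (F.P K) k (SU N) => tkBranchOfRecord F N V ν M g K W' s S k Φ (baseCfg k U₀) * f U₀)
      (fieldMeasure (F.P K) k (SU N)) :=
    hB.mul_bdd hfm.aestronglyMeasurable (c := Cf) (Filter.Eventually.of_forall fun U₀ => by rw [Real.norm_eq_abs]; exact hfb U₀)
  -- on `f ≠ 0` the two branch operators agree at the base configuration (§1 with the ambient predicate `f((ω k).1) ≠ 0`)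
  have heq : (fun U₀ : GaugeField (F.P K) k (SU N) => f U₀ * tkBranchOfRecord F N V ν M g K W s S k Φ (baseCfg k U₀)) =
      fun U₀ => tkBranchOfRecord F N V ν M g K W' s S k Φ (baseCfg k U₀) * f U₀ := by
    funext U₀
    by_cases hf0 : f U₀ = 0
    · rw [hf0, zero_mul, mul_zero]
    · rw [mul_comm]
      congr 1
      refine (tkBranchOfRecord_congr_on_reading_locus₂ ν M g K W W' s S k (baseCfg (V := V) k U₀)
        (fun ω => ∃ U : GaugeField (F.P K) k (SU N), f U ≠ 0 ∧ ∀ i, k ≤ i → ω i = baseCfg (V := V) k U i)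
        (fun ω ω' hag hω => ?_) (fun j _ => rfl) hζloc (fun j hj ω' hAω hlow hsupp => ?_) Φ (baseCfg k U₀) ⟨U₀, hf0, fun i _ => rfl⟩
        (fun i _ => rfl)).symm
      · obtain ⟨U, hU, hbase⟩ := hω
        exact ⟨U, hU, fun i hi => by rw [hag i hi]; exact hbase i hi⟩
      · rw [hw']
        refine Set.indicator_of_mem ?_ _
        refine hdom j hj ω' (fun i hi => ?_) hAω hsupp
        rw [hlow i hi]
        have hik : i ≠ k := Nat.ne_of_lt (lt_trans hi hj)
        exact Prod.ext (baseCfg_fst_of_ne (V := V) hik U₀) (baseCfg_snd (V := V) k i U₀)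
  rw [heq]
  exact hBf

end ReadingLocus

/-! ## §4  ★★★ At the `CoPH` record shape, GENERIC `θ`, TWO-SCALE locality of `θ.zhAt p s′` displayed: `front · (old branch)` integrable from coercivity ON THE READING LOCUS -/
section Record

variable {F : T4Family} {N : ℕ} [NeZero N]
variable (θ : Stage13HParams F N) (p : B12.RunParams)

/-- **★★★ `U₀ ↦ f(U₀)·𝐓_k(init s′, S)[Φ](base_k U₀)` IS INTEGRABLE FROM COERCIVITY OF THE RESIDUAL's `quad` ON THE READING LOCUS**, generic `θ`, any history `s′`
of length `k+1`, any branch `S`, any operand `Φ` of r11's shape, any bounded measurable front factor `f`: (i) residual rows — `zhLaws`, `ZhUnity`, LOCALITY in the TWO-SCALE form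
(displayed; implied by the core proviso `zhLocal`, §1), measurability of `ζ0_j(Y)`∕`quad_j(Λ′)`; (ii⁵) per generation `j < k` a `c_j > 0` with `c_j·Σ_{b∈sA_j} ‖A_j(b)‖² ≤ quad_j(Λ_{j+1}(init s′))(ω′)` at every
`ω′` ON THE READING LOCUS — (L1) scales `< j` at the base `(1, 0)`, (L2) scales `≥ k` as in `base_k U` for some `U` with `f U ≠ 0`, (L3) for every `i ∈ [j,k)` an
`A_i`-fibre-mate with `ζ0_i((Ω_{i+1}(init s′))ᶜ) ≠ 0` ([I]'s positivity of `𝒬_j` exactly where 11a reads it; displayed); (iii) `Φ` measurable, `0 ≤ Φ ≤ CΦ`.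
[cite: Balaban1988Convergent, (2.18) p.257, (2.20)–(2.23) p.258, (2.10) p.256, (3.16)–(3.21) pp.268–269, (3.23)–(3.24) p.270; Balaban1987RG1, (2.11) p.267 (shape of the row)] -/
theorem integrable_front_mul_oldBranch_of_coercive_on_reading_locus₂
    (hZ : ∀ (p : B12.RunParams) (n : ℕ) (Ω Λ : ℕ → Set (Site (F.P p.K) 0)), (θ.Zh p n Ω Λ).Laws) (hU : θ.ZhUnity F N) {k : ℕ}
    (s : SeqOfRecord F θ.ν θ.τ9.M (gOfRecord₁₃ F N θ.toStage13Params p) p.K (k + 1)) (hloc₂ : (θ.zhAt p s).LocalLaws₂)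
    (S : ℕ → Set (Site (F.P p.K) 0))
    (hζm : ∀ j (Y : Set (Site (F.P p.K) 0)), Measurable ((θ.zhAt p s).ζ0 j Y))
    (hqm : ∀ j (Λ' : Set (Site (F.P p.K) 0)), Measurable ((θ.zhAt p s).quad j Λ'))
    (f : GaugeField (F.P p.K) k (SU N) → ℝ) (hfm : Measurable f) (Cf : ℝ) (hfb : ∀ U, |f U| ≤ Cf)
    (hcoer : ∀ j : ℕ, j < k → ∃ c : ℝ, 0 < c ∧ ∀ ω' : MultiCfg (F.P p.K) (SU N) (FluctV N),
      (∀ i, i < j → ω' i = ((fun _ => 1), (fun _ => 0))) →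
      (∃ U : GaugeField (F.P p.K) k (SU N), f U ≠ 0 ∧ ∀ i, k ≤ i → ω' i = baseCfg (V := FluctV N) k U i) →
      (∀ i, j ≤ i → i < k → ∃ cf : JCfg (F.P p.K) i (SU N) (FluctV N), cf.1 = (ω' i).1 ∧
        (∀ b, b ∉ bondsIn i ((s.init.Λ (i + 1))ᶜ ∩ s.init.Ω (i + 1)) → cf.2 b = (ω' i).2 b) ∧
        (θ.zhAt p s).ζ0 i (s.init.Ω (i + 1))ᶜ (Function.update ω' i cf) ≠ 0) →
      c * ∑ b ∈ (Set.toFinite (bondsIn j ((s.init.Λ (j + 1))ᶜ ∩ s.init.Ω (j + 1)))).toFinset, ‖(ω' j).2 b‖ ^ 2 ≤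
        (θ.zhAt p s).quad j (s.init.Λ (j + 1)) ω')
    {Φ : SFluct (F.P p.K) (FluctV N) → MSField (F.P p.K) (SU N) → ℝ}
    (hΦm : Measurable fun ω : MultiCfg (F.P p.K) (SU N) (FluctV N) => Φ (S, fun j => (ω j).2) (fun j => (ω j).1))
    (hΦ0 : ∀ a U, 0 ≤ Φ a U) (CΦ : ℝ) (hΦle : ∀ a U, Φ a U ≤ CΦ) :
    Integrable (fun U₀ : GaugeField (F.P p.K) k (SU N) => f U₀ *
      tkBranchOfRecord F N (FluctV N) θ.ν θ.τ9.M _ p.K (WtOfRecord₁₃H F N θ p s) s.init S k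
        (fun ω => Φ (S, fun j => (ω j).2) (fun j => (ω j).1)) (baseCfg (V := FluctV N) k U₀)) (fieldMeasure (F.P p.K) k (SU N)) := by
  have hWlaws : (WtOfRecord₁₃H F N θ p s).Laws := WtOfRecord₁₃H_laws hZ p s
  -- per generation: a Gaussian majorant (with `c := 1` when `j ≥ k`, where the row is not asked)
  have hrow : ∀ j : ℕ, ∃ ŵ : (↥(Set.toFinite (bondsIn j ((s.init.Λ (j + 1))ᶜ ∩ s.init.Ω (j + 1)))).toFinset → FluctV N) → ℝ≥0∞,
      Measurable ŵ ∧
      (∫⁻ a, ŵ a ∂(Measure.pi fun _ : ↥(Set.toFinite (bondsIn j ((s.init.Λ (j + 1))ᶜ ∩ s.init.Ω (j + 1)))).toFinset =>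
        (volume : Measure (FluctV N)))) ≠ ⊤ ∧
      ∀ ω' : MultiCfg (F.P p.K) (SU N) (FluctV N), (j < k ∧ (∀ i, i < j → ω' i = ((fun _ => 1), (fun _ => 0))) ∧
        (∃ U : GaugeField (F.P p.K) k (SU N), f U ≠ 0 ∧ ∀ i, k ≤ i → ω' i = baseCfg (V := FluctV N) k U i) ∧
        ∀ i, j ≤ i → i < k → ∃ cf : JCfg (F.P p.K) i (SU N) (FluctV N), cf.1 = (ω' i).1 ∧
          (∀ b, b ∉ bondsIn i ((s.init.Λ (i + 1))ᶜ ∩ s.init.Ω (i + 1)) → cf.2 b = (ω' i).2 b) ∧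
          (θ.zhAt p s).ζ0 i (s.init.Ω (i + 1))ᶜ (Function.update ω' i cf) ≠ 0) →
        ENNReal.ofReal ((WtOfRecord₁₃H F N θ p s).w j (s.init.Λ (j + 1)) ((s.init.Λ (j + 1))ᶜ ∩ s.init.Ω (j + 1)) (S (j + 1)) ω') ≤
          ŵ (fun b : ↥(Set.toFinite (bondsIn j ((s.init.Λ (j + 1))ᶜ ∩ s.init.Ω (j + 1)))).toFinset => (ω' j).2 b) := fun j => by
    by_cases hj : j < k
    · obtain ⟨c, hc, h⟩ := hcoer j hj
      exact afibre_dominated_under_of_coercive_under θ.ν θ.A₁ p (gOfRecord₁₃ F N θ.toStage13Params p) (θ.zhAt p s) j _ _ _ _ hc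
        fun ω' hpre => h ω' hpre.2.1 hpre.2.2.1 hpre.2.2.2
    · exact afibre_dominated_under_of_coercive_under θ.ν θ.A₁ p (gOfRecord₁₃ F N θ.toStage13Params p) (θ.zhAt p s) j _ _ _ _ one_pos
        fun ω' hpre => absurd hpre.1 hj
  choose ŵ hŵm hŵfin hdom using hrow
  refine integrable_front_mul_tkBranchOfRecord_baseCfg_of_dominated_on_reading_locus₂ θ.ν θ.τ9.M (gOfRecord₁₃ F N θ.toStage13Params p) p.K
    (WtOfRecord₁₃H F N θ p s) s.init S k
    (fun j => measurable_WtOfRecord₁₃H_ζ θ p s j _ (hζm j _)) (fun j ω => hWlaws.zeta_nonneg j _ ω) (fun j ω => ?_)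
    (fun j _ ω ω' hω hω' => hloc₂.zeta0_twoScale j _ ω ω' hω hω')
    (fun j => measurable_WtOfRecord₁₃H_w θ p s j _ _ _ (hqm j _)) (fun j ω => TkWeights.w_nonneg hWlaws j _ _ _ ω) ŵ hŵm f hfm Cf hfb
    (fun j hj ω' hlow hbase hsupp => hdom j ω' ⟨hj, hlow, hbase, hsupp⟩)
    (fun j => (∫⁻ a, ŵ j a ∂(Measure.pi fun _ : ↥(Set.toFinite (bondsIn j ((s.init.Λ (j + 1))ᶜ ∩ s.init.Ω (j + 1)))).toFinset =>
      (volume : Measure (FluctV N)))).toNNReal)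
    (fun j => le_of_eq (ENNReal.coe_toNNReal (hŵfin j)).symm) hΦm (fun ω => hΦ0 _ _) CΦ (fun ω => hΦle _ _)
  -- `ζ_j(Y) = ζ0_j(Y) ≤ 1`
  rw [WtOfRecord₁₃H_eq_tkWeightsOfRecordP, tkWeightsOfRecordP_ζ_apply]
  exact zhAt_ζ0_le_one_of_unity θ p hZ hU s j _ ω

end Record

end Summit.QuantumFields.YangMills.Theorems.BalabanUVNodesN11TwoScaleLocalityReadingLocus

end
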